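import Summits.BirchSwinnertonDyer.Rank1Residual.GaloisImage.CyclotomicGroupRingEvaluationPadic
import HarnessLib

/-!
# MAIN GLUE of the evaluation dictionary: PK-3's identity in `(ℤ/p^K)[(ℤ/n)ˣ]` ⟹ PK-5's premise
# `hval` in `ℚ_p ⊗_ℚ ℚ(ζ_n)` (cell `b2b-bsdres`, team n1011, ROUTE-1 PORT (P-KIM); OWNERS row T-PKEV,
# file E-C; seat p02 GEN 12)

HONEST FRAMING (cell `b2b-bsdres`, run/shared/lean/b2b/bsd-rank1-residual/, verbatim in every
file): the goal of the cell is to DELETE the COMBINATION-SHAPED residual classes of the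
Birch–Swinnerton-Dyer formula for ALL analytic-rank `≤ 1` elliptic curves over `ℚ` — "full BSD
formula for every rank `≤ 1` curve in class `C`" assembled STRICTLY from published theorems — so
that the rank-`≤ 1` remainder becomes exactly the CONSTRUCTION-SHAPED classes, which are TYPED
(missing-input `Prop`s), NOT attempted. This is not "finishing BSD". Team n1011 (N10/N11; ROUTE 1,
the PORT anatomy (P-KIM) of class X4 ∧ `p = 3`): research route on CONSTRUCTION-SHAPED classes;
prove what is provable now; no claim beyond stated classes; census output = EVIDENCE, never a
Literature fact; RESIDUAL-MAP marks UNCHANGED; nothing is booked by this file. TOOL THEOREMS ONLY: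
no definition, no named fact, no instance, no `sorry`.

## What

Files E-A (`ℚ[(ℤ/n)ˣ]` acting on `ℚ(ζ_n)`, Ramanujan's sum) and E-B (`ev_p(Θ) = Σ_g (Θ_g : ℚ_p) ⊗ σ_g ζ_n`,
the lattice `L_int = cycIntLattice p n`, congruences mod `p^K`) assembled into what the PORT's END consumes:

* ★★ `exists_mem_cycIntLattice_deriv_sub_tmul_eq_pow_smul` — FROM PK-3's exact conclusion shape
  `Θ̄·∏_i D_i = c·∏_i Nrm_i` in `(ℤ/p^K)[(ℤ/n)ˣ]` (`MazurTateDerivative.mapRingHom_padicLift_mul_prod_deriv_…`,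
  `c = (−1)^{ν(n)} δ̃_n`) TO PK-5's premise shape (`KatoExpStarFiniteLevelAt.toZModPow_eq_of_premise`,
  `hval`): `∃ l ∈ cycIntLattice p n, 𝔇^{tensor}(ev_p Θ) − ((c̃ : ℚ_p)·μ(n)) ⊗ 1 = p^K • l` for every lift
  `c̃` of `c`, `𝔇^{tensor}` PK-1's / THEOREM A3's `s.noncommProd` operator over any finite index set `s`;
* `…_of_toZModPow_eq` — ANY scalar `s ∈ ℤ_p` with `s ≡ c·μ(n)` (the literal `(s : ℚ_p) ⊗ 1` shape;
  p13's ask); `…_of_squarefree` — PK-3's indexing `ℓ : n.primeFactors`, `N_ℓ = ℓ − 1`, `hgen`;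
* `exists_mem_cycIntLattice_one_tmul_deriv_sub_tmul_eq_pow_smul` — RATIONAL coefficients
  (`hΘ : (Θ_g : ℚ_p) = (X_g : ℚ)`): the value is `1 ⊗ 𝔇^{field}(Σ_g X_g • σ_g ζ_n)`, PK-1 ★2's output shape
  once PK-4 writes `x_{0,r} = Σ_g X_g • σ_g ζ_n`; `…_of_comparison` — the same from
  `X·∏D = Θ·∏D + p^K·W` in `ℚ_p[(ℤ/n)ˣ]` (p15's PK-4b-C interface: NO integrality of the avatar `X`).

Consumers BY NAME: PK-6 at a general level (p13 skel v0.4 (11)), PK-4b-C (p15; r1 D-55-3 (a)).  HONEST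
LIMITS: pure algebra; no `ZetaBody` / Euler system / `exp*` / modular symbol / Kolyvagin statement used or
proved; `Θ̄·∏D = c·∏Nrm` is a HYPOTHESIS (PK-3 proves it); closes nothing; books nothing; 0 defs / 0 facts.

References: C.-H. Kim, AJM 148 (2026) = arXiv:2203.12159, proof of Thm. 3.13 (arXiv v3 pp. 26–28;
= AJM Thm. 3.11) [Kim2022StructureSelmer]; C.-H. Kim, K. Nakamura, JNT 210 (2020) Prop. 3.5, Rem. 3.6
[KimNakamura2020]; K. Rubin, *Euler Systems* (2000) Def. 4.4.1 [Rubin2000]; bookkeeping [folklore].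
-/

noncomputable section

open scoped BigOperators TensorProduct
open Finset

namespace Summit.BirchSwinnertonDyer.Rank1Residual.GaloisImage

namespace GroupRingEval

open Literature.NumberTheory.EllipticCurves.Kato2004.EulerSystemValues

variable (p : ℕ) [Fact p.Prime] (n : ℕ) [NeZero n]

/-! ### §1 MAIN GLUE: PK-3's identity in `(ℤ/p^K)[(ℤ/n)ˣ]` ⟹ PK-5's premise in `ℚ_p ⊗ ℚ(ζ_n)` -/

/-- `mapRingHom` commutes with scalars: `(c • X)‾ = c̄ • X̄`. [folklore] -/
theorem mapRingHom_smul {R S : Type*} [CommSemiring R] [CommSemiring S] {G : Type*} [Monoid G]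
    (f : R →+* S) (c : R) (X : MonoidAlgebra R G) :
    MonoidAlgebra.mapRingHom G f (c • X) = f c • MonoidAlgebra.mapRingHom G f X := by
  refine MonoidAlgebra.coeff_injective (Finsupp.ext fun g => ?_)
  rw [MonoidAlgebra.coeff_mapRingHom, MonoidAlgebra.coeff_smul_apply, MonoidAlgebra.coeff_smul_apply,
    MonoidAlgebra.coeff_mapRingHom, smul_eq_mul, smul_eq_mul, map_mul]

/-- The group-ring derivative / norm elements with `ℤ_p`-coefficients reduce to the ones with
`ℤ/p^K`-coefficients (PK-3's) and lift to the ones with `ℚ_p`-coefficients (§2's). [folklore] -/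
theorem mapRingHom_prod_sum_single_pow {R S : Type*} [CommSemiring R] [CommSemiring S]
    {G : Type*} [CommMonoid G] (f : R →+* S) {ι : Type*} (d : Finset ι) (b : ι → G) (N : ι → ℕ)
    (a : ∀ i, Fin (N i) → R) :
    MonoidAlgebra.mapRingHom G f (∏ i ∈ d, ∑ j : Fin (N i), MonoidAlgebra.single (b i ^ (j : ℕ)) (a i j)) =
      ∏ i ∈ d, ∑ j : Fin (N i), MonoidAlgebra.single (b i ^ (j : ℕ)) (f (a i j)) := by
  rw [map_prod]
  refine Finset.prod_congr rfl fun i _ => ?_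
  rw [map_sum]
  refine Finset.sum_congr rfl fun j _ => ?_
  rw [MonoidAlgebra.mapRingHom_single]

set_option backward.isDefEq.respectTransparency false in
/-- **The `ℤ_p`-integral derivative through `ev_p`**: `ev_p(Θ·∏_i D_i) = 𝔇^{tensor}(ev_p Θ)` for
`Θ ∈ ℤ_p[(ℤ/n)ˣ]` (E-B §2 after `ℤ_p ↪ ℚ_p`). [cite: Rubin2000, Def. 4.4.1] -/
theorem sum_coeff_mul_prod_deriv_coe_tmul_sigma {ι : Type*} (d : Finset ι) (b : ι → (ZMod n)ˣ)
    (N : ι → ℕ) (Θ : MonoidAlgebra ℤ_[p] (ZMod n)ˣ) (z : CyclotomicField n ℚ)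
    (comm : (d : Set ι).Pairwise fun i i' => Commute
      (∑ j ∈ Finset.range (N i), (j : Module.End ℚ (ℚ_[p] ⊗[ℚ] CyclotomicField n ℚ)) *
        (Algebra.TensorProduct.map (AlgHom.id ℚ ℚ_[p])
          (sigma n (b i) : CyclotomicField n ℚ →ₐ[ℚ] CyclotomicField n ℚ)).toLinearMap ^ j)
      (∑ j ∈ Finset.range (N i'), (j : Module.End ℚ (ℚ_[p] ⊗[ℚ] CyclotomicField n ℚ)) *
        (Algebra.TensorProduct.map (AlgHom.id ℚ ℚ_[p])
          (sigma n (b i') : CyclotomicField n ℚ →ₐ[ℚ] CyclotomicField n ℚ)).toLinearMap ^ j)) :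
    ∑ g : (ZMod n)ˣ, (((Θ * ∏ i ∈ d, ∑ j : Fin (N i),
        MonoidAlgebra.single (b i ^ (j : ℕ)) ((j : ℕ) : ℤ_[p])).coeff g : ℤ_[p]) : ℚ_[p]) ⊗ₜ[ℚ]
          sigma n g z =
      (d.noncommProd (fun i => ∑ j ∈ Finset.range (N i),
        (j : Module.End ℚ (ℚ_[p] ⊗[ℚ] CyclotomicField n ℚ)) *
          (Algebra.TensorProduct.map (AlgHom.id ℚ ℚ_[p])
            (sigma n (b i) : CyclotomicField n ℚ →ₐ[ℚ] CyclotomicField n ℚ)).toLinearMap ^ j) comm)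
        (∑ g : (ZMod n)ˣ, ((Θ.coeff g : ℤ_[p]) : ℚ_[p]) ⊗ₜ[ℚ] sigma n g z) := by
  have hDQ : MonoidAlgebra.mapRingHom (ZMod n)ˣ (PadicInt.Coe.ringHom (p := p)) Θ *
      ∏ i ∈ d, ∑ j : Fin (N i), MonoidAlgebra.single (b i ^ (j : ℕ)) ((j : ℕ) : ℚ_[p]) =
      MonoidAlgebra.mapRingHom (ZMod n)ˣ (PadicInt.Coe.ringHom (p := p))
        (Θ * ∏ i ∈ d, ∑ j : Fin (N i), MonoidAlgebra.single (b i ^ (j : ℕ)) ((j : ℕ) : ℤ_[p])) := by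
    rw [map_mul, mapRingHom_prod_sum_single_pow]
    simp_rw [map_natCast]
  have hQ := sum_coeff_mul_prod_deriv_tmul_sigma p n d b N
    (MonoidAlgebra.mapRingHom (ZMod n)ˣ (PadicInt.Coe.ringHom (p := p)) Θ) z comm
  rw [hDQ] at hQ
  simp_rw [MonoidAlgebra.coeff_mapRingHom] at hQ
  have hcoe : ∀ x : ℤ_[p], PadicInt.Coe.ringHom x = (x : ℚ_[p]) := fun _ => rfl
  simp_rw [hcoe] at hQ
  exact hQ

set_option backward.isDefEq.respectTransparency false in
/-- **★★ MAIN GLUE (PK-3's conclusion shape IN, PK-5's premise shape OUT).**  Let `Θ ∈ ℤ_p[(ℤ/n)ˣ]`,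
units `b_i ∈ (ℤ/n)ˣ` with lengths `N_i`, and suppose in `(ℤ/p^K)[(ℤ/n)ˣ]`
`Θ̄ · ∏_i Σ_{j<N_i} δ_{b_i^j}·j = c · ∏_i Σ_{j<N_i} δ_{b_i^j}` — token-identically the conclusion of
PK-3 `MazurTateDerivative.mapRingHom_padicLift_mul_prod_deriv_eq_kuriharaNumber_smul` (there
`c = (−1)^{ν(n)} δ̃_n`) — and that the norm elements multiply to the full norm element
(`prod_norm_eq_sum_single` of file E-A: PK-3's `hgen` + `#(ℤ/n)ˣ = ∏ N_i`).  Then for every lift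
`c̃ ∈ ℤ_p` of `c`:
`∃ l ∈ L_int(n), 𝔇^{tensor}(Σ_g (Θ_g : ℚ_p) ⊗ σ_g ζ_n) − ((c̃ : ℚ_p)·μ(n)) ⊗ 1 = p^K • l`,
`𝔇^{tensor} = ∏_i Σ_{j<N_i} j·(1 ⊗ σ_{b_i})^j` PK-1's operator — the `hval` premise shape of
`KatoExpStarFiniteLevelAt.apply_localization_eq_toZModPow` / `toZModPow_eq_of_premise` (PK-5).
[cite: Kim2022StructureSelmer, the proof of Thm. 3.13 (arXiv v3 pp. 26–28; = Thm. 3.11 of AJM 148)]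
[cite: KimNakamura2020, Prop. 3.5 and Rem. 3.6 (arXiv v2 pp. 8–9)] -/
theorem exists_mem_cycIntLattice_deriv_sub_tmul_eq_pow_smul {ι : Type*} (d : Finset ι)
    (b : ι → (ZMod n)ˣ) (N : ι → ℕ) (Θ : MonoidAlgebra ℤ_[p] (ZMod n)ˣ) (K : ℕ) (c : ZMod (p ^ K))
    (hD : MonoidAlgebra.mapRingHom (ZMod n)ˣ (PadicInt.toZModPow K) Θ *
        ∏ i ∈ d, ∑ j : Fin (N i), MonoidAlgebra.single (b i ^ (j : ℕ)) ((j : ℕ) : ZMod (p ^ K)) =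
      c • ∏ i ∈ d, ∑ j : Fin (N i), MonoidAlgebra.single (b i ^ (j : ℕ)) (1 : ZMod (p ^ K)))
    (hnorm : ∏ i ∈ d, ∑ j : Fin (N i), MonoidAlgebra.single (b i ^ (j : ℕ)) (1 : ℤ_[p]) =
      ∑ g : (ZMod n)ˣ, MonoidAlgebra.single g 1)
    (c' : ℤ_[p]) (hc : PadicInt.toZModPow K c' = c)
    (comm : (d : Set ι).Pairwise fun i i' => Commute
      (∑ j ∈ Finset.range (N i), (j : Module.End ℚ (ℚ_[p] ⊗[ℚ] CyclotomicField n ℚ)) *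
        (Algebra.TensorProduct.map (AlgHom.id ℚ ℚ_[p])
          (sigma n (b i) : CyclotomicField n ℚ →ₐ[ℚ] CyclotomicField n ℚ)).toLinearMap ^ j)
      (∑ j ∈ Finset.range (N i'), (j : Module.End ℚ (ℚ_[p] ⊗[ℚ] CyclotomicField n ℚ)) *
        (Algebra.TensorProduct.map (AlgHom.id ℚ ℚ_[p])
          (sigma n (b i') : CyclotomicField n ℚ →ₐ[ℚ] CyclotomicField n ℚ)).toLinearMap ^ j)) :
    ∃ l ∈ cycIntLattice p n,
      (d.noncommProd (fun i => ∑ j ∈ Finset.range (N i),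
        (j : Module.End ℚ (ℚ_[p] ⊗[ℚ] CyclotomicField n ℚ)) *
          (Algebra.TensorProduct.map (AlgHom.id ℚ ℚ_[p])
            (sigma n (b i) : CyclotomicField n ℚ →ₐ[ℚ] CyclotomicField n ℚ)).toLinearMap ^ j) comm)
        (∑ g : (ZMod n)ˣ, ((Θ.coeff g : ℤ_[p]) : ℚ_[p]) ⊗ₜ[ℚ]
          sigma n g (IsCyclotomicExtension.zeta n ℚ (CyclotomicField n ℚ))) -
        ((c' : ℚ_[p]) * (ArithmeticFunction.moebius n : ℚ_[p])) ⊗ₜ[ℚ] (1 : CyclotomicField n ℚ) =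
      ((p : ℤ_[p]) ^ K) • l := by
  -- the two `ℤ_p`-integral elements `Θ·∏D` and `c̃·∏Nrm` agree mod `p^K`
  have hcong : MonoidAlgebra.mapRingHom (ZMod n)ˣ (PadicInt.toZModPow K)
      (Θ * ∏ i ∈ d, ∑ j : Fin (N i), MonoidAlgebra.single (b i ^ (j : ℕ)) ((j : ℕ) : ℤ_[p])) =
      MonoidAlgebra.mapRingHom (ZMod n)ˣ (PadicInt.toZModPow K)
        (c' • ∏ i ∈ d, ∑ j : Fin (N i), MonoidAlgebra.single (b i ^ (j : ℕ)) (1 : ℤ_[p])) := by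
    rw [map_mul, mapRingHom_prod_sum_single_pow, mapRingHom_smul, mapRingHom_prod_sum_single_pow, hc]
    simp_rw [map_natCast, map_one]
    exact hD
  obtain ⟨l, hl, hval⟩ :=
    exists_mem_cycIntLattice_sub_eq_pow_smul_of_mapRingHom_eq p n K _ _ hcong
  refine ⟨l, hl, ?_⟩
  rw [← hval, hnorm, sum_tmul_sigma_zeta_smul_sum_single]
  congr 1
  exact (sum_coeff_mul_prod_deriv_coe_tmul_sigma p n d b N Θ _ comm).symm

set_option backward.isDefEq.respectTransparency false in
/-- **MAIN GLUE, `hval`'s literal scalar shape** (p13's interface `skel/T-PORT-1-PKIM.md` v0.4 (11)):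
for ANY `s ∈ ℤ_p` with `s ≡ c·μ(n) (mod p^K)` — stated `toZModPow K s = c · μ(n)` —
`∃ l ∈ L_int(n), 𝔇^{tensor}(ev_p Θ) − (s : ℚ_p) ⊗ 1 = p^K • l` (the defect against the lift
`c.val · μ(n)` is `p^K w ⊗ 1 ∈ p^K · L_int`).
[cite: Kim2022StructureSelmer, the proof of Thm. 3.13 (arXiv v3 pp. 26–28; = Thm. 3.11 of AJM 148)] -/
theorem exists_mem_cycIntLattice_deriv_sub_tmul_eq_pow_smul_of_toZModPow_eq {ι : Type*} (d : Finset ι)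
    (b : ι → (ZMod n)ˣ) (N : ι → ℕ) (Θ : MonoidAlgebra ℤ_[p] (ZMod n)ˣ) (K : ℕ)
    (c : ZMod (p ^ K))
    (hD : MonoidAlgebra.mapRingHom (ZMod n)ˣ (PadicInt.toZModPow K) Θ *
        ∏ i ∈ d, ∑ j : Fin (N i), MonoidAlgebra.single (b i ^ (j : ℕ)) ((j : ℕ) : ZMod (p ^ K)) =
      c • ∏ i ∈ d, ∑ j : Fin (N i), MonoidAlgebra.single (b i ^ (j : ℕ)) (1 : ZMod (p ^ K)))
    (hnorm : ∏ i ∈ d, ∑ j : Fin (N i), MonoidAlgebra.single (b i ^ (j : ℕ)) (1 : ℤ_[p]) =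
      ∑ g : (ZMod n)ˣ, MonoidAlgebra.single g 1)
    (s : ℤ_[p])
    (hs : PadicInt.toZModPow K s = c * ((ArithmeticFunction.moebius n : ℤ) : ZMod (p ^ K)))
    (comm : (d : Set ι).Pairwise fun i i' => Commute
      (∑ j ∈ Finset.range (N i), (j : Module.End ℚ (ℚ_[p] ⊗[ℚ] CyclotomicField n ℚ)) *
        (Algebra.TensorProduct.map (AlgHom.id ℚ ℚ_[p])
          (sigma n (b i) : CyclotomicField n ℚ →ₐ[ℚ] CyclotomicField n ℚ)).toLinearMap ^ j)
      (∑ j ∈ Finset.range (N i'), (j : Module.End ℚ (ℚ_[p] ⊗[ℚ] CyclotomicField n ℚ)) *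
        (Algebra.TensorProduct.map (AlgHom.id ℚ ℚ_[p])
          (sigma n (b i') : CyclotomicField n ℚ →ₐ[ℚ] CyclotomicField n ℚ)).toLinearMap ^ j)) :
    ∃ l ∈ cycIntLattice p n,
      (d.noncommProd (fun i => ∑ j ∈ Finset.range (N i),
        (j : Module.End ℚ (ℚ_[p] ⊗[ℚ] CyclotomicField n ℚ)) *
          (Algebra.TensorProduct.map (AlgHom.id ℚ ℚ_[p])
            (sigma n (b i) : CyclotomicField n ℚ →ₐ[ℚ] CyclotomicField n ℚ)).toLinearMap ^ j) comm)
        (∑ g : (ZMod n)ˣ, ((Θ.coeff g : ℤ_[p]) : ℚ_[p]) ⊗ₜ[ℚ]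
          sigma n g (IsCyclotomicExtension.zeta n ℚ (CyclotomicField n ℚ))) -
        (s : ℚ_[p]) ⊗ₜ[ℚ] (1 : CyclotomicField n ℚ) =
      ((p : ℤ_[p]) ^ K) • l := by
  haveI : NeZero (p ^ K) := ⟨pow_ne_zero _ (Fact.out : p.Prime).ne_zero⟩
  obtain ⟨l, hl, h⟩ := exists_mem_cycIntLattice_deriv_sub_tmul_eq_pow_smul p n d b N Θ K c hD hnorm
    ((c.val : ℕ) : ℤ_[p]) (by rw [map_natCast, ZMod.natCast_zmod_val]) comm
  -- `s − c.val·μ(n) = w·p^K`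
  have hker : s - ((c.val : ℕ) : ℤ_[p]) * ((ArithmeticFunction.moebius n : ℤ) : ℤ_[p]) ∈
      RingHom.ker (PadicInt.toZModPow K) := by
    rw [RingHom.mem_ker, map_sub, map_mul, map_natCast, map_intCast, ZMod.natCast_zmod_val, hs,
      sub_self]
  rw [PadicInt.ker_toZModPow] at hker
  obtain ⟨w, hw⟩ := Ideal.mem_span_singleton'.1 hker
  refine ⟨l - ((w : ℤ_[p]) : ℚ_[p]) ⊗ₜ[ℚ] (1 : CyclotomicField n ℚ),
    Submodule.sub_mem _ hl (coe_tmul_one_mem_cycIntLattice p n w), ?_⟩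
  have hs' : (s : ℚ_[p]) = ((c.val : ℕ) : ℚ_[p]) * (ArithmeticFunction.moebius n : ℚ_[p]) +
      (w : ℚ_[p]) * (p : ℚ_[p]) ^ K := by
    have hw' := congrArg (fun x : ℤ_[p] => (x : ℚ_[p])) hw
    push_cast at hw'
    linear_combination -hw'
  rw [smul_sub, ← h, hs', TensorProduct.add_tmul, sub_add_eq_sub_sub]
  congr 1
  rw [TensorProduct.smul_tmul', Algebra.smul_def, map_pow, map_natCast, mul_comm]

set_option backward.isDefEq.respectTransparency false in
/-- The MAIN GLUE in PK-3's indexing (`ℓ : n.primeFactors`, `N_ℓ = ℓ − 1`), with the norm-element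
hypothesis discharged from PK-3's `hgen` and `n` square-free (file E-A `prod_norm_eq_sum_single`,
`card_units_zmod_eq_prod_sub_one`). [cite: KimNakamura2020, Prop. 3.5 and Rem. 3.6 (arXiv v2 pp. 8–9)] -/
theorem exists_mem_cycIntLattice_deriv_sub_tmul_eq_pow_smul_of_squarefree (hn : Squarefree n)
    (σ : n.primeFactors → (ZMod n)ˣ) (Θ : MonoidAlgebra ℤ_[p] (ZMod n)ˣ) (K : ℕ) (c : ZMod (p ^ K))
    (hD : MonoidAlgebra.mapRingHom (ZMod n)ˣ (PadicInt.toZModPow K) Θ *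
        ∏ ℓ : n.primeFactors, ∑ j : Fin ((ℓ : ℕ) - 1),
          MonoidAlgebra.single (σ ℓ ^ (j : ℕ)) ((j : ℕ) : ZMod (p ^ K)) =
      c • ∏ ℓ : n.primeFactors, ∑ j : Fin ((ℓ : ℕ) - 1),
          MonoidAlgebra.single (σ ℓ ^ (j : ℕ)) (1 : ZMod (p ^ K)))
    (hgen : ∀ a : (ZMod n)ˣ, ∃ e : ∀ ℓ : n.primeFactors, Fin ((ℓ : ℕ) - 1),
      a = ∏ ℓ, σ ℓ ^ (e ℓ : ℕ))
    (c' : ℤ_[p]) (hc : PadicInt.toZModPow K c' = c)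
    (comm : ((Finset.univ : Finset n.primeFactors) : Set n.primeFactors).Pairwise fun ℓ ℓ' =>
      Commute
      (∑ j ∈ Finset.range ((ℓ : ℕ) - 1), (j : Module.End ℚ (ℚ_[p] ⊗[ℚ] CyclotomicField n ℚ)) *
        (Algebra.TensorProduct.map (AlgHom.id ℚ ℚ_[p])
          (sigma n (σ ℓ) : CyclotomicField n ℚ →ₐ[ℚ] CyclotomicField n ℚ)).toLinearMap ^ j)
      (∑ j ∈ Finset.range ((ℓ' : ℕ) - 1), (j : Module.End ℚ (ℚ_[p] ⊗[ℚ] CyclotomicField n ℚ)) *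
        (Algebra.TensorProduct.map (AlgHom.id ℚ ℚ_[p])
          (sigma n (σ ℓ') : CyclotomicField n ℚ →ₐ[ℚ] CyclotomicField n ℚ)).toLinearMap ^ j)) :
    ∃ l ∈ cycIntLattice p n,
      (Finset.univ.noncommProd (fun ℓ : n.primeFactors => ∑ j ∈ Finset.range ((ℓ : ℕ) - 1),
        (j : Module.End ℚ (ℚ_[p] ⊗[ℚ] CyclotomicField n ℚ)) *
          (Algebra.TensorProduct.map (AlgHom.id ℚ ℚ_[p])
            (sigma n (σ ℓ) : CyclotomicField n ℚ →ₐ[ℚ] CyclotomicField n ℚ)).toLinearMap ^ j) comm)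
        (∑ g : (ZMod n)ˣ, ((Θ.coeff g : ℤ_[p]) : ℚ_[p]) ⊗ₜ[ℚ]
          sigma n g (IsCyclotomicExtension.zeta n ℚ (CyclotomicField n ℚ))) -
        ((c' : ℚ_[p]) * (ArithmeticFunction.moebius n : ℚ_[p])) ⊗ₜ[ℚ] (1 : CyclotomicField n ℚ) =
      ((p : ℤ_[p]) ^ K) • l := by
  classical
  exact exists_mem_cycIntLattice_deriv_sub_tmul_eq_pow_smul p n Finset.univ σ (fun ℓ => (ℓ : ℕ) - 1)
    Θ K c hD
    (prod_norm_eq_sum_single σ _ hgen (card_units_zmod_eq_prod_sub_one n hn)) c' hc comm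

/-! ### §2 Rational coefficients: the value `1 ⊗ (Σ_g X_g • σ_g ζ_n)` -/

/-- **Rational specialisation of the value**: under PK-3's integrality binder shape
`hΘ : (Θ_g : ℚ_p) = (X_g : ℚ)` (`X_g ∈ ℚ` — e.g. the modular symbols `[g/n]⁺` of the Mazur–Tate
element), `ev_p Θ = 1 ⊗ (Σ_g X_g • σ_g ζ_n)` — a pure tensor on the FIELD-side action of file E-A.
[folklore] -/
theorem sum_tmul_sigma_eq_one_tmul_sum_smul_sigma (Θ : MonoidAlgebra ℤ_[p] (ZMod n)ˣ)
    (X : (ZMod n)ˣ → ℚ) (hΘ : ∀ g : (ZMod n)ˣ, ((Θ.coeff g : ℤ_[p]) : ℚ_[p]) = ((X g : ℚ) : ℚ_[p]))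
    (z : CyclotomicField n ℚ) :
    ∑ g : (ZMod n)ˣ, ((Θ.coeff g : ℤ_[p]) : ℚ_[p]) ⊗ₜ[ℚ] sigma n g z =
      (1 : ℚ_[p]) ⊗ₜ[ℚ] ∑ g : (ZMod n)ˣ, X g • sigma n g z := by
  rw [TensorProduct.tmul_sum]
  refine Finset.sum_congr rfl fun g _ => ?_
  rw [hΘ, ← Rat.smul_one_eq_cast, TensorProduct.smul_tmul]

/-- The inclusion `w ↦ 1 ⊗ w` carries PK-1's FIELD-level derivative operator to its TENSOR-level one
(b-indexed form of `ZetaValue.includeRight_apply_deriv`). [folklore] -/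
theorem one_tmul_fieldDeriv_eq_tensorDeriv {ι : Type*} (b : ι → (ZMod n)ˣ) (N : ι → ℕ)
    (d : Finset ι) (comm) (comm') (w : CyclotomicField n ℚ) :
    (1 : ℚ_[p]) ⊗ₜ[ℚ] (d.noncommProd (fun i => ∑ j ∈ Finset.range (N i),
        (j : Module.End ℚ (CyclotomicField n ℚ)) *
          (sigma n (b i) : CyclotomicField n ℚ →ₐ[ℚ] CyclotomicField n ℚ).toLinearMap ^ j) comm w) =
      (d.noncommProd (fun i => ∑ j ∈ Finset.range (N i),
        (j : Module.End ℚ (ℚ_[p] ⊗[ℚ] CyclotomicField n ℚ)) *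
          (Algebra.TensorProduct.map (AlgHom.id ℚ ℚ_[p])
            (sigma n (b i) : CyclotomicField n ℚ →ₐ[ℚ] CyclotomicField n ℚ)).toLinearMap ^ j) comm')
        ((1 : ℚ_[p]) ⊗ₜ[ℚ] w) :=
  ZetaValue.addMonoidHom_apply_noncommProd_deriv
    ((TensorProduct.mk ℚ ℚ_[p] (CyclotomicField n ℚ) (1 : ℚ_[p])).toAddMonoidHom) _ _ N d
    (fun i _ v => by simp) comm comm' w

set_option backward.isDefEq.respectTransparency false in
/-- **★★ MAIN GLUE, rational form.**  If the `p`-integral structure `Θ` has RATIONAL coefficients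
`X_g` (`hΘ`, PK-3's binder shape) and satisfies PK-3's identity `Θ̄·∏D = c·∏Nrm` in
`(ℤ/p^K)[(ℤ/n)ˣ]`, then the pure tensor `1 ⊗ 𝔇^{field}(Σ_g X_g • σ_g ζ_n)` — PK-1 ★2's output shape
for Kato's `x_{0,r} = Σ_g X_g • σ_g ζ_n` — satisfies PK-5's premise with the scalar `c̃·μ(n)`:
`∃ l ∈ L_int(n), 1 ⊗ 𝔇^{field}(Σ_g X_g • σ_g ζ_n) − ((c̃ : ℚ_p)·μ(n)) ⊗ 1 = p^K • l`.
[cite: Kim2022StructureSelmer, the proof of Thm. 3.13 (arXiv v3 pp. 26–28; = Thm. 3.11 of AJM 148)]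
[cite: KimNakamura2020, Prop. 3.5 and Rem. 3.6 (arXiv v2 pp. 8–9)] -/
theorem exists_mem_cycIntLattice_one_tmul_deriv_sub_tmul_eq_pow_smul {ι : Type*} (d : Finset ι)
    (b : ι → (ZMod n)ˣ) (N : ι → ℕ) (Θ : MonoidAlgebra ℤ_[p] (ZMod n)ˣ)
    (X : (ZMod n)ˣ → ℚ) (hΘ : ∀ g : (ZMod n)ˣ, ((Θ.coeff g : ℤ_[p]) : ℚ_[p]) = ((X g : ℚ) : ℚ_[p]))
    (K : ℕ) (c : ZMod (p ^ K))
    (hD : MonoidAlgebra.mapRingHom (ZMod n)ˣ (PadicInt.toZModPow K) Θ *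
        ∏ i ∈ d, ∑ j : Fin (N i), MonoidAlgebra.single (b i ^ (j : ℕ)) ((j : ℕ) : ZMod (p ^ K)) =
      c • ∏ i ∈ d, ∑ j : Fin (N i), MonoidAlgebra.single (b i ^ (j : ℕ)) (1 : ZMod (p ^ K)))
    (hnorm : ∏ i ∈ d, ∑ j : Fin (N i), MonoidAlgebra.single (b i ^ (j : ℕ)) (1 : ℤ_[p]) =
      ∑ g : (ZMod n)ˣ, MonoidAlgebra.single g 1)
    (c' : ℤ_[p]) (hc : PadicInt.toZModPow K c' = c)
    (comm : (d : Set ι).Pairwise fun i i' => Commute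
      (∑ j ∈ Finset.range (N i), (j : Module.End ℚ (CyclotomicField n ℚ)) *
        (sigma n (b i) : CyclotomicField n ℚ →ₐ[ℚ] CyclotomicField n ℚ).toLinearMap ^ j)
      (∑ j ∈ Finset.range (N i'), (j : Module.End ℚ (CyclotomicField n ℚ)) *
        (sigma n (b i') : CyclotomicField n ℚ →ₐ[ℚ] CyclotomicField n ℚ).toLinearMap ^ j)) :
    ∃ l ∈ cycIntLattice p n,
      (1 : ℚ_[p]) ⊗ₜ[ℚ] (d.noncommProd (fun i => ∑ j ∈ Finset.range (N i),
        (j : Module.End ℚ (CyclotomicField n ℚ)) *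
          (sigma n (b i) : CyclotomicField n ℚ →ₐ[ℚ] CyclotomicField n ℚ).toLinearMap ^ j) comm
        (∑ g : (ZMod n)ˣ, X g • sigma n g (IsCyclotomicExtension.zeta n ℚ (CyclotomicField n ℚ)))) -
        ((c' : ℚ_[p]) * (ArithmeticFunction.moebius n : ℚ_[p])) ⊗ₜ[ℚ] (1 : CyclotomicField n ℚ) =
      ((p : ℤ_[p]) ^ K) • l := by
  obtain ⟨l, hl, h⟩ := exists_mem_cycIntLattice_deriv_sub_tmul_eq_pow_smul p n d b N Θ K c hD hnorm c'
    hc (ZetaValue.pairwise_commute_tensorDeriv p n b N d)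
  refine ⟨l, hl, ?_⟩
  rw [← h, sum_tmul_sigma_eq_one_tmul_sum_smul_sigma p n Θ X hΘ, one_tmul_fieldDeriv_eq_tensorDeriv]

set_option backward.isDefEq.respectTransparency false in
/-- `1 ⊗ (Σ_g X_g • σ_g z) = Σ_g (X_g : ℚ_p) ⊗ σ_g z` for a RATIONAL group-ring element `X` mapped into
`ℚ_p[(ℤ/n)ˣ]`. [folklore] -/
theorem one_tmul_sum_coeff_smul_sigma (X : MonoidAlgebra ℚ (ZMod n)ˣ) (z : CyclotomicField n ℚ) :
    (1 : ℚ_[p]) ⊗ₜ[ℚ] (∑ g : (ZMod n)ˣ, X.coeff g • sigma n g z) =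
      ∑ g : (ZMod n)ˣ, (MonoidAlgebra.mapRingHom (ZMod n)ˣ (algebraMap ℚ ℚ_[p]) X).coeff g ⊗ₜ[ℚ]
        sigma n g z := by
  rw [TensorProduct.tmul_sum]
  refine Finset.sum_congr rfl fun g _ => ?_
  rw [MonoidAlgebra.coeff_mapRingHom, eq_ratCast, ← Rat.smul_one_eq_cast, TensorProduct.smul_tmul]

set_option backward.isDefEq.respectTransparency false in
/-- **★★ MAIN GLUE, comparison form (p15's PK-4b-C interface).**  Let `X ∈ ℚ[(ℤ/n)ˣ]` (the Kato-side
avatar, NOT assumed integral), `Θ, W ∈ ℤ_p[(ℤ/n)ˣ]`, and suppose in `ℚ_p[(ℤ/n)ˣ]`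
`X·∏_i D_i = Θ·∏_i D_i + p^K·W` (`hXY`: the derivative kills the non-integral discrepancy up to
`p^K`×integral — R1-71 (i) / p15's `prod_deriv_mul_sub_mem`) and PK-3's identity for `Θ` (`hD`).  Then
`∃ l ∈ L_int(n), 1 ⊗ 𝔇^{field}(Σ_g X_g • σ_g ζ_n) − ((c̃ : ℚ_p)·μ(n)) ⊗ 1 = p^K • l`: the `hval`
premise of PK-5 for PK-1 ★2's value `1 ⊗ 𝔇^{field} x_{0,r}` once `x_{0,r} = Σ_g X_g • σ_g ζ_n`
(T-PKEV E-D), with NO integrality of `X` asked.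
[cite: Kim2022StructureSelmer, the proof of Thm. 3.13 (arXiv v3 pp. 26–28; = Thm. 3.11 of AJM 148)] -/
theorem exists_mem_cycIntLattice_one_tmul_deriv_sub_tmul_eq_pow_smul_of_comparison {ι : Type*}
    (d : Finset ι) (b : ι → (ZMod n)ˣ) (N : ι → ℕ) (X : MonoidAlgebra ℚ (ZMod n)ˣ)
    (Θ W : MonoidAlgebra ℤ_[p] (ZMod n)ˣ) (K : ℕ) (c : ZMod (p ^ K))
    (hXY : MonoidAlgebra.mapRingHom (ZMod n)ˣ (algebraMap ℚ ℚ_[p]) X *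
        ∏ i ∈ d, ∑ j : Fin (N i), MonoidAlgebra.single (b i ^ (j : ℕ)) ((j : ℕ) : ℚ_[p]) =
      MonoidAlgebra.mapRingHom (ZMod n)ˣ (PadicInt.Coe.ringHom (p := p))
          (Θ * ∏ i ∈ d, ∑ j : Fin (N i), MonoidAlgebra.single (b i ^ (j : ℕ)) ((j : ℕ) : ℤ_[p])) +
        ((p : ℚ_[p]) ^ K) • MonoidAlgebra.mapRingHom (ZMod n)ˣ (PadicInt.Coe.ringHom (p := p)) W)
    (hD : MonoidAlgebra.mapRingHom (ZMod n)ˣ (PadicInt.toZModPow K) Θ *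
        ∏ i ∈ d, ∑ j : Fin (N i), MonoidAlgebra.single (b i ^ (j : ℕ)) ((j : ℕ) : ZMod (p ^ K)) =
      c • ∏ i ∈ d, ∑ j : Fin (N i), MonoidAlgebra.single (b i ^ (j : ℕ)) (1 : ZMod (p ^ K)))
    (hnorm : ∏ i ∈ d, ∑ j : Fin (N i), MonoidAlgebra.single (b i ^ (j : ℕ)) (1 : ℤ_[p]) =
      ∑ g : (ZMod n)ˣ, MonoidAlgebra.single g 1)
    (c' : ℤ_[p]) (hc : PadicInt.toZModPow K c' = c)
    (comm : (d : Set ι).Pairwise fun i i' => Commute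
      (∑ j ∈ Finset.range (N i), (j : Module.End ℚ (CyclotomicField n ℚ)) *
        (sigma n (b i) : CyclotomicField n ℚ →ₐ[ℚ] CyclotomicField n ℚ).toLinearMap ^ j)
      (∑ j ∈ Finset.range (N i'), (j : Module.End ℚ (CyclotomicField n ℚ)) *
        (sigma n (b i') : CyclotomicField n ℚ →ₐ[ℚ] CyclotomicField n ℚ).toLinearMap ^ j)) :
    ∃ l ∈ cycIntLattice p n,
      (1 : ℚ_[p]) ⊗ₜ[ℚ] (d.noncommProd (fun i => ∑ j ∈ Finset.range (N i),
        (j : Module.End ℚ (CyclotomicField n ℚ)) *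
          (sigma n (b i) : CyclotomicField n ℚ →ₐ[ℚ] CyclotomicField n ℚ).toLinearMap ^ j) comm
        (∑ g : (ZMod n)ˣ, X.coeff g • sigma n g (IsCyclotomicExtension.zeta n ℚ (CyclotomicField n ℚ)))) -
        ((c' : ℚ_[p]) * (ArithmeticFunction.moebius n : ℚ_[p])) ⊗ₜ[ℚ] (1 : CyclotomicField n ℚ) =
      ((p : ℤ_[p]) ^ K) • l := by
  have commT := ZetaValue.pairwise_commute_tensorDeriv p n b N d
  obtain ⟨l₁, hl₁, h₁⟩ := exists_mem_cycIntLattice_deriv_sub_tmul_eq_pow_smul p n d b N Θ K c hD hnorm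
    c' hc commT
  refine ⟨l₁ + ∑ g : (ZMod n)ˣ, ((W.coeff g : ℤ_[p]) : ℚ_[p]) ⊗ₜ[ℚ]
      sigma n g (IsCyclotomicExtension.zeta n ℚ (CyclotomicField n ℚ)),
    Submodule.add_mem _ hl₁ (sum_coeff_tmul_sigma_zeta_mem_cycIntLattice p n W), ?_⟩
  -- `1 ⊗ 𝔇^{field}(ev X) = 𝔇^{tensor}(ev_p X) = ev_p(X·∏D) = ev_p(Θ·∏D) + p^K • ev_p(W)`
  rw [one_tmul_fieldDeriv_eq_tensorDeriv p n b N d comm commT, one_tmul_sum_coeff_smul_sigma,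
    ← sum_coeff_mul_prod_deriv_tmul_sigma p n d b N _ _ commT, hXY]
  simp_rw [MonoidAlgebra.coeff_add, Finsupp.add_apply, TensorProduct.add_tmul, Finset.sum_add_distrib,
    MonoidAlgebra.coeff_mapRingHom, MonoidAlgebra.coeff_smul_apply, MonoidAlgebra.coeff_mapRingHom]
  have hcoe : ∀ x : ℤ_[p], PadicInt.Coe.ringHom x = (x : ℚ_[p]) := fun _ => rfl
  simp_rw [hcoe, smul_eq_mul]
  rw [sum_coeff_mul_prod_deriv_coe_tmul_sigma p n d b N Θ _ commT, smul_add, ← h₁]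
  -- the `p^K • W` part
  have hW : ∑ g : (ZMod n)ˣ, ((p : ℚ_[p]) ^ K * ((W.coeff g : ℤ_[p]) : ℚ_[p])) ⊗ₜ[ℚ]
      sigma n g (IsCyclotomicExtension.zeta n ℚ (CyclotomicField n ℚ)) =
      ((p : ℤ_[p]) ^ K) • ∑ g : (ZMod n)ˣ, ((W.coeff g : ℤ_[p]) : ℚ_[p]) ⊗ₜ[ℚ]
        sigma n g (IsCyclotomicExtension.zeta n ℚ (CyclotomicField n ℚ)) := by
    rw [Finset.smul_sum]
    refine Finset.sum_congr rfl fun g _ => ?_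
    rw [TensorProduct.smul_tmul', Algebra.smul_def, map_pow, map_natCast]
  rw [hW]
  abel


end GroupRingEval

end Summit.BirchSwinnertonDyer.Rank1Residual.GaloisImage

end
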